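import Summits.Ventures.PercRepro.LemmaBPlusK5Def

/-!
# Faces of `K₅`: kernel slices 28 … 31 (part H)

Each theorem is one `decide +kernel` at default heartbeats (≈ 55 s: the 1024-row table of the marking
plus ≤ 22 000 face points in sub-mask loops); generated by `tools/gen_k5.py`.
-/

namespace PercRepro

namespace Examples

open MultiGraph

/-- Slice 28: joins `u ∈ [891, 895)` of the faces of `K₅` (21870 face points). -/
theorem k5_slice_28 : k5.FacesSRange ![0, 1, 2, 3] 891 895 := by decide +kernel

/-- Slice 29: joins `u ∈ [895, 907)` of the faces of `K₅` (21978 face points). -/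
theorem k5_slice_29 : k5.FacesSRange ![0, 1, 2, 3] 895 907 := by decide +kernel

/-- Slice 30: joins `u ∈ [907, 927)` of the faces of `K₅` (18792 face points). -/
theorem k5_slice_30 : k5.FacesSRange ![0, 1, 2, 3] 907 927 := by decide +kernel

/-- Slice 31: joins `u ∈ [927, 943)` of the faces of `K₅` (20736 face points). -/
theorem k5_slice_31 : k5.FacesSRange ![0, 1, 2, 3] 927 943 := by decide +kernel

end Examples

end PercRepro
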